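import Summits.BirchSwinnertonDyer.BirchSwinnertonDyer.Theorems.KolyvaginDepthDoorKolyvaginDepthSupplyDoor
import Summits.BirchSwinnertonDyer.BirchSwinnertonDyer.Theorems.Rank2Observatory389a1RankTwo
import Literature.NumberTheory.EllipticCurves.GlobalMinimalModelNumberFieldBaseChangeProofs
import HarnessLib

/-!
# Route `KolyvaginDepthDoor` — the depth-table ROW CERTIFICATE instantiated on the calibration
# curve `389a1` (crux `KolyvaginDepthSupply`, stmt-BirchSwinnertonDyer-21765)

Helper file (`--supports stmt-BirchSwinnertonDyer-21765 --as helper`); it closes nothing and BSD is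
not proved by it. HONEST FRAMING: a per-curve certificate FORMAT; the computed bit `c_M(ℓ) ≠ 0`
is a HYPOTHESIS here (it is the output of the route's DEPTH TABLE instrument — the
Jetchev–Lauter–Stein algorithm, arXiv:0707.0032 §3.6, whose Prop. 3.10 records `κ_{5,1} ≠ 0` for
`389a1` at `p = 3`, `K = ℚ(√−7)`, below the `p ≥ 5` of Kolyvagin's structure theorem as vendored,
hence a calibration point, not an instance), and Kolyvagin 1991 Thm. 4 (`hF`) is a named fact.

`389a1` (`y² + y = x³ + x² − 2x`, Cremona; the smallest-conductor curve of rank 2) is the route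
header's "known data point". The tree already proves, in the kernel and with no hypothesis,
`2 ≤ rank_ℤ E(ℚ)` for it (`Rank2Observatory.Curve389a1.two_le_mordellWeilRank`: two independent
points by reduction witnesses). The door of `KolyvaginDepthDoorKolyvaginDepthSupplyDoor` needs
exactly a LOWER bound `ν(n) + 1 ≤ rank`, so on `389a1` a single non-zero first derived class
`c_M(ℓ) ≠ 0` at an admissible `(p, K, ℓ, M)` certifies AT ONCE — modulo `hF` —
`corank_{ℤ_p} Ш(E)[p^∞] = 0`, `corank Sel_{p^∞}(E/ℚ) = 2`, `corank Sel_{p^∞}(E^{(d_K)}/ℚ) = 1`,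
AND the exact rank `rank_ℤ E(ℚ) = 2` (the upper bound coming from Kolyvagin's structure theorem,
not from a 2-descent).

* `curve389a1_isGloballyMinimal` — `[0,1,1,−2,0]` is a global minimal model (`Δ = 389` is
  square-free; Silverman's `Δ`-criterion `isGloballyMinimal_baseChange_int_of_finrank_mul_lt_twelve`).
  Unconditional; supplies the instance binder of the certificate.
* `curve389a1_neZero_conductorNorm` — `N_E ≠ 0` (supplies the other binder).
* `curve389a1_depthRow_certificate` — the row certificate.
* `depthRow_certificate_of_two_le_rank` (appended) — the generic row certificate for ANY globally
  minimal `E/ℚ` with a certified lower bound `2 ≤ rank_ℤ E(ℚ)`, concluding `rank = 2` exactly.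

References: [Kolyvagin1991MathAnn] §2 Thm. 4; [JetchevLauterStein2009] arXiv:0707.0032, §3.6,
Prop. 3.10; [CremonaAlgorithms1997] Table 1 (389A1); [SilvermanAEC2009] VII.1 Rem. 1.1, VIII.8.
-/

set_option linter.dupNamespace false

noncomputable section

open scoped Classical

namespace Summit.BirchSwinnertonDyer.BirchSwinnertonDyer.Theorems.KolyvaginDepthDoor

open Literature.NumberTheory.EllipticCurves Literature.NumberTheory.EllipticCurves.ModularForms
  WeierstrassCurve
open Summit.BirchSwinnertonDyer.BirchSwinnertonDyer.Rank2Observatory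

/-- **`389a1 = [0, 1, 1, −2, 0]` is a global minimal Weierstrass equation** (unconditional): it is
the base change of an integer equation with square-free discriminant `Δ = 389` (a prime), so
`q² ∤ Δ` for every prime `q` and `[ℚ : ℚ]·1 < 12`; Silverman's criterion
(`isGloballyMinimal_baseChange_int_of_finrank_mul_lt_twelve`, AEC VII.1 Rem. 1.1 and VIII.8).
[cite: CremonaAlgorithms1997, Table 1 (389A1)] [cite: SilvermanAEC2009, VII.1 Remark 1.1 and VIII.8] -/
theorem curve389a1_isGloballyMinimal : Curve389a1.E.IsGloballyMinimal := by
  have h : Curve389a1.E = (⟨0, 1, 1, -2, 0⟩ : WeierstrassCurve ℤ).baseChange ℚ := by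
    ext <;> simp [Curve389a1.E, WeierstrassCurve.baseChange, WeierstrassCurve.map]
  rw [h]
  refine isGloballyMinimal_baseChange_int_of_finrank_mul_lt_twelve _ ℚ 1 (fun q hq hdvd ↦ ?_)
    (by rw [Module.finrank_self]; omega)
  have hD : (⟨0, 1, 1, -2, 0⟩ : WeierstrassCurve ℤ).Δ = 389 := by
    simp only [WeierstrassCurve.Δ, WeierstrassCurve.b₂, WeierstrassCurve.b₄, WeierstrassCurve.b₆,
      WeierstrassCurve.b₈]
    norm_num
  rw [hD] at hdvd
  have h1 : q ^ 2 ∣ 389 := by exact_mod_cast Int.natAbs_dvd_natAbs.mpr hdvd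
  have h389 : Nat.Prime 389 := by norm_num
  have hqd : q ∣ 389 := (dvd_pow_self q two_ne_zero).trans h1
  rcases (Nat.dvd_prime h389).mp hqd with hq1 | hq389
  · exact Nat.prime_one_false (hq1 ▸ hq)
  · rw [hq389] at h1
    have h2 : 389 ^ 2 ≤ 389 := Nat.le_of_dvd (by norm_num) h1
    norm_num at h2

/-- `N_E ≠ 0` for `389a1` (the conductor norm of an elliptic curve is positive,
`conductorNorm_pos_holds`). [folklore] -/
theorem curve389a1_neZero_conductorNorm : NeZero (Curve389a1.E.conductorNorm ℤ) :=
  ⟨(Curve389a1.E.conductorNorm_pos_holds).ne'⟩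

/-- **The depth-table row certificate on `389a1` (modulo Kolyvagin 1991, Thm. 4).** Let `p ≥ 5`
be a prime of good reduction for `E = 389a1` with `ρ̄_{E,p}` surjective, `K` an imaginary
quadratic field with the Heegner hypothesis for `N_E`, `d_K ∉ {−3, −4}`, `p ∤ d_K`; fix a modular
parametrisation datum `Dt`, an orientation `β`, an embedding `ι : K → ℂ`, ONE Kolyvagin prime `ℓ`
(`Zhang2014.IsKolyvaginPrime`), a Kolyvagin–Heegner datum `d` of conductor `ℓ` and a level
`1 ≤ M ≤ M(ℓ)`. IF the first derived class does not vanish, `c_M(ℓ) ≠ 0` (the depth-table bit), THEN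
`corank_{ℤ_p} Ш(E/ℚ)[p^∞] = 0`, `rank_ℤ E(ℚ) = 2` (exactly: the lower bound is the tree's kernel
certificate `Curve389a1.two_le_mordellWeilRank`, the upper bound is Kolyvagin's),
`corank Sel_{p^∞}(E/ℚ) = 2` and `corank Sel_{p^∞}(E^{(d_K)}/ℚ) = 1`. The instance binders are
discharged by `curve389a1_isGloballyMinimal` and `curve389a1_neZero_conductorNorm`. CONDITIONAL on
`hF` and on the computed bit; per-curve; BSD is not proved by it.
[cite: Kolyvagin1991MathAnn, §2 Thm. 4] [cite: JetchevLauterStein2009, §3.6 and Prop. 3.10 (arXiv:0707.0032)]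
[cite: CremonaAlgorithms1997, Table 1 (389A1)] -/
theorem curve389a1_depthRow_certificate [Curve389a1.E.IsGloballyMinimal]
    [NeZero (Curve389a1.E.conductorNorm ℤ)]
    (hF : Kolyvagin1991_selmerCorank_of_kolyvaginClass_ne_zero)
    (p : ℕ) [hp : Fact p.Prime] (h5 : 5 ≤ p) (hgood : Curve389a1.E.HasGoodReductionAtPrime p)
    (hsurj : Curve389a1.E.HasSurjectiveModNGaloisRep p)
    (K : Type) [Field K] [NumberField K] (hK : IsImaginaryQuadratic K)
    (h3 : NumberField.discr K ≠ -3) (h4 : NumberField.discr K ≠ -4)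
    (hpd : ¬ ((p : ℤ) ∣ NumberField.discr K))
    (hH : SatisfiesHeegnerHypothesis (Curve389a1.E.conductorNorm ℤ) K)
    (Dt : ModularParametrizationData Curve389a1.E (Curve389a1.E.conductorNorm ℤ)) (β : ℤ)
    (ι : K →+* ℂ) (ℓ : ℕ) (hℓ : ℓ.Prime)
    (hkol : Zhang2014.IsKolyvaginPrime (Curve389a1.E.conductorNorm ℤ) Curve389a1.E K p ℓ)
    (d : KolyvaginHeegnerData Dt β ι ℓ) (M : ℕ) (hM : 1 ≤ M)
    (hMle : (M : ℕ∞) ≤ Zhang2014.levelIndex Curve389a1.E p ℓ)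
    (hne : d.kolyvaginClass hp.out M ≠ 0) :
    Curve389a1.E.shaCorank p = 0 ∧ Curve389a1.E.mordellWeilRank = 2 ∧
      Curve389a1.E.selmerCorank p = 2 ∧
      (Curve389a1.E.quadraticTwist (NumberField.discr K : ℚ)).selmerCorank p = 1 := by
  have hpN : ¬ (p ∣ Curve389a1.E.conductorNorm ℤ) := fun h ↦
    (Curve389a1.E.dvd_conductorNorm_iff_not_hasGoodReductionAtPrime p).mp h hgood
  have hΛ : KolyvaginDescent.KolSupp
      (Zhang2014.IsKolyvaginPrime (Curve389a1.E.conductorNorm ℤ) Curve389a1.E K p) ℓ :=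
    KolyvaginDescent.kolSupp_prime hℓ hkol
  have hcard : ℓ.primeFactors.card = 1 := by
    rw [hℓ.primeFactors, Finset.card_singleton]
  have hlow : 2 ≤ Curve389a1.E.mordellWeilRank := Curve389a1.two_le_mordellWeilRank
  obtain ⟨ht, hc, hν, hc', hev⟩ :=
    shaCorank_eq_zero_of_kolyvaginClass_ne_zero_of_depth_lt_rank hF Curve389a1.E p h5 hsurj K hK h3
      h4 hpd hpN hH Dt β ι ℓ d M hΛ hM hMle hne (by omega)
  have hr : Curve389a1.E.mordellWeilRank = 2 := by omega
  refine ⟨ht, hr, by omega, ?_⟩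
  rw [hr] at hc' hev
  have h2 := Nat.even_iff.mp hev
  omega

/-! ## Appended: the generic row certificate from a certified LOWER rank bound -/

/-- **Rank-2 row certificate for ANY curve with a certified lower bound `2 ≤ rank_ℤ E(ℚ)` (modulo
Kolyvagin 1991, Thm. 4)** — the generic form of `curve389a1_depthRow_certificate`: `E/ℚ` globally
minimal with `2 ≤ rank_ℤ E(ℚ)` (the form in which ranks are certified in the kernel, e.g. the tree's
`Rank2Observatory` reduction witnesses), `p ≥ 5` with `ρ̄_{E,p}` onto and `p ∤ N_E`, `K` an
admissible Heegner field, ONE Kolyvagin prime `ℓ`, a datum of conductor `ℓ`, `1 ≤ M ≤ M(ℓ)`. A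
non-zero first derived class `c_M(ℓ) ≠ 0` gives `corank_{ℤ_p} Ш(E/ℚ)[p^∞] = 0`, `rank_ℤ E(ℚ) = 2`
EXACTLY (upper bound from Kolyvagin, no 2-descent), `corank Sel_{p^∞}(E/ℚ) = 2`,
`corank Sel_{p^∞}(E^{(d_K)}/ℚ) = 1`. CONDITIONAL on `hF` and on the computed bit; per-curve; BSD is
not proved by it. [cite: Kolyvagin1991MathAnn, §2 Thm. 4] [cite: WZhang2014, Thm. 11.2 (i) (p. 248)]
[cite: JetchevLauterStein2009, §3.6 (arXiv:0707.0032)] -/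
theorem depthRow_certificate_of_two_le_rank
    (hF : Kolyvagin1991_selmerCorank_of_kolyvaginClass_ne_zero)
    (W : WeierstrassCurve ℚ) [W.IsElliptic] [W.IsGloballyMinimal] (hr : 2 ≤ W.mordellWeilRank)
    (p : ℕ) [hp : Fact p.Prime] (h5 : 5 ≤ p) (hsurj : W.HasSurjectiveModNGaloisRep p)
    (K : Type) [Field K] [NumberField K] (hK : IsImaginaryQuadratic K)
    (h3 : NumberField.discr K ≠ -3) (h4 : NumberField.discr K ≠ -4)
    (hpd : ¬ ((p : ℤ) ∣ NumberField.discr K)) (hpN : ¬ (p ∣ W.conductorNorm ℤ))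
    [NeZero (W.conductorNorm ℤ)] (hH : SatisfiesHeegnerHypothesis (W.conductorNorm ℤ) K)
    (Dt : ModularParametrizationData W (W.conductorNorm ℤ)) (β : ℤ) (ι : K →+* ℂ)
    (ℓ : ℕ) (hℓ : ℓ.Prime) (hkol : Zhang2014.IsKolyvaginPrime (W.conductorNorm ℤ) W K p ℓ)
    (d : KolyvaginHeegnerData Dt β ι ℓ) (M : ℕ)
    (hM : 1 ≤ M) (hMle : (M : ℕ∞) ≤ Zhang2014.levelIndex W p ℓ)
    (hne : d.kolyvaginClass hp.out M ≠ 0) :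
    W.shaCorank p = 0 ∧ W.mordellWeilRank = 2 ∧ W.selmerCorank p = 2 ∧
      (W.quadraticTwist (NumberField.discr K : ℚ)).selmerCorank p = 1 := by
  have hΛ : KolyvaginDescent.KolSupp (Zhang2014.IsKolyvaginPrime (W.conductorNorm ℤ) W K p) ℓ :=
    KolyvaginDescent.kolSupp_prime hℓ hkol
  have hcard : ℓ.primeFactors.card = 1 := by
    rw [hℓ.primeFactors, Finset.card_singleton]
  obtain ⟨ht, hc, hν, hc', hev⟩ :=
    shaCorank_eq_zero_of_kolyvaginClass_ne_zero_of_depth_lt_rank hF W p h5 hsurj K hK h3 h4 hpd hpN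
      hH Dt β ι ℓ d M hΛ hM hMle hne (by omega)
  have hr2 : W.mordellWeilRank = 2 := by omega
  refine ⟨ht, hr2, by omega, ?_⟩
  rw [hr2] at hc' hev
  have h2 := Nat.even_iff.mp hev
  omega

end Summit.BirchSwinnertonDyer.BirchSwinnertonDyer.Theorems.KolyvaginDepthDoor

end
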